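import Summits.NavierStokesRegularity.FunctionalMining.StretchingSubclasses
import Summits.NavierStokesRegularity.FunctionalMining.StretchingLowerFamilyKill
import HarnessLib

/-!
# FunctionalMining — K1-Q1 CLASS constants: `C_𝒞 := inf {C | σ ≤ C‖ω‖_∞ℰ on the class 𝒞}` (dict seat, staged; part 1 of 2)

NS FUNCTIONAL MINING cell (`pub-nsfunc`), dictionary seat gen 7 — **search for candidate a priori
estimates; no regularity claim.** STATIC field inequalities only: nothing about Navier–Stokes solutions
is asserted anywhere in this file.

The K0 row `E.q=2|T_C|C1` (`StretchingSupBound C`: `∫⟪(v·∇)v, Δv⟫ ≤ C·M·ℰ(v)` whenever `|ω|² ≤ M²`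
pointwise) has the optimal constant `C⋆ = stretchingSupConst` (tree `StretchingConst.lean`, p204885).
The cell's K1-Q1 analysis (bank `K1Q1-HALF.md`, `K1Q1-PRESSURELESS.md`; DICTIONARY §14) found that the
natural intermediate objects are CLASS constants: the same infimum with the fields restricted to a class
`𝒞`. This file types them once — `StretchingSupBoundOn 𝒞 C`, `stretchingSupConstOn 𝒞` with the order
bookkeeping of `StretchingConst.lean` (valid set = non-empty up-set, `le_…` from a violation INSIDE the
class, `… ≤ stretchingSupConst`, attainment) — for two classes on `T³`, using ONLY tree files:

* the **pressureless-gradient class** `IsPressurelessGrad v :⟺ |S(x)|_F² = ½|ω(x)|² ∀ x`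
  (equivalently `tr((∇v)²) = 0`, i.e. the NS pressure of the datum is constant):
  **`√(71−17√17)/4 ≤ stretchingSupConstOn IsPressurelessGrad ≤ 2√3/9`** (upper half = tree
  `enstrophyProduction_le_of_strainSq_eq_half_vorticitySq`, `StretchingSubclasses.lean` p206571:
  Betchov–Miller `σ = −4∫det S ≤ (2√6/9)∫|S|³`; lower half = the prove seat's planar family
  `StretchFamily.u n τ` (`StretchingLowerFamily(Kill).lean` p205637/p205856), which lies in the class
  because its gradient is nilpotent (`StretchFamily.isPressurelessGrad_u`), with its kills re-run INSIDE a
  class (`StretchFamily.not_stretchingSupBoundOn_of_lt_r`) and its envelope `√(71−17√17)/4 ≈ 0.2381`);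
* the **2½-D class** `IsTwoHalfD v :⟺ ∃ k, ∂ₖv ≡ 0`:
  **`√(71−17√17)/4 ≤ stretchingSupConstOn IsTwoHalfD ≤ 1/2`** (the same family has `∂₂u ≡ 0`,
  `StretchFamily.isTwoHalfD_u`; upper half = tree `stretchingSupBoundPlanar_half`).

Part 2 (`StretchingClassConstShear.lean`, after the prove seat's `StretchingLowerShearKill.lean`) raises
both lower halves to `2√3/9` with the composition fields `(0, −c g(x₀), T(x₁+g(x₀)))`, whence
**`stretchingSupConstOn IsPressurelessGrad = 2√3/9` EXACTLY** and `2√3/9 ≤ C_{2.5D} ≤ 1/2`. The bank's hand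
theorems (K1Q1-HALF Thm 1/2: `C_{2.5D} = 1/2`; Thm 3: `C⋆ ≥ 0.5307`) are NOT formalised (typed as nodes in
`StretchingNestedTargets.lean`). Both class constants are `≤ stretchingSupConst`
(`stretchingSupConstOn_le_stretchingSupConst`). [ours; elementary order bookkeeping + the cited tree theorems]
-/

noncomputable section

open Set Filter Topology MeasureTheory

namespace Summit.NavierStokesRegularity.FunctionalMining

open Literature.Analysis Literature.Analysis.FunctionSpaces Literature.Analysis.FunctionSpaces.Torus
open Literature.Analysis.FluidPDE

variable {d : Type*} [Fintype d] [DecidableEq d]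

/-! ## 1. The row restricted to a class of fields, and its optimal constant -/

/-- **The K1-Q1 row on a class `𝒞`**: for every smooth divergence-free `v ∈ 𝒞` on the unit 3-torus and
every pointwise vorticity majorant `M ≥ 0`, `∫⟪(v·∇)v, Δv⟫ ≤ C·M·ℰ(v)`. A FIELD inequality (no time, no
solution); `𝒞 = ⊤` is `StretchingSupBound C`, `𝒞 = IsTwoHalfD` is `StretchingSupBoundPlanar C`. Search for
candidate a priori estimates; no regularity claim. [ours] -/
def StretchingSupBoundOn (𝒞 : (UnitAddTorus d → EuclideanSpace ℝ d) → Prop) (C : ℝ) : Prop :=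
  Fintype.card d = 3 → ∀ v : UnitAddTorus d → EuclideanSpace ℝ d,
    Torus.IsSmooth v → Torus.IsDivFree v → 𝒞 v →
      ∀ M : ℝ, 0 ≤ M → (∀ x, torusVorticitySqAt v x ≤ M ^ 2) →
        enstrophyProduction v ≤ C * M * torusEnstrophy v

/-- **The class constant `C_𝒞`**: the infimum of the constants valid on `𝒞` (Mathlib's junk value `0`
if the valid set were all of `ℝ`, e.g. for a class without any stretching field). [ours] -/
def stretchingSupConstOn (𝒞 : (UnitAddTorus d → EuclideanSpace ℝ d) → Prop) : ℝ :=
  sInf {C | StretchingSupBoundOn 𝒞 C}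

variable {𝒞 𝒟 : (UnitAddTorus d → EuclideanSpace ℝ d) → Prop}

/-- The full row implies the row on every class. [ours; elementary] -/
theorem StretchingSupBound.on {C : ℝ} (h : StretchingSupBound (d := d) C) :
    StretchingSupBoundOn 𝒞 C := fun hd v hv hdiv _ M hM hω => h hd v hv hdiv M hM hω

/-- The row on the trivial class is the full row. [ours; elementary] -/
theorem stretchingSupBoundOn_top_iff {C : ℝ} :
    StretchingSupBoundOn (fun _ : UnitAddTorus d → EuclideanSpace ℝ d => True) C ↔
      StretchingSupBound (d := d) C :=
  ⟨fun h hd v hv hdiv M hM hω => h hd v hv hdiv trivial M hM hω, fun h => h.on⟩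

/-- The row on the 2½-D class is the dict seat's `StretchingSupBoundPlanar` (definitionally). [ours; bookkeeping] -/
theorem stretchingSupBoundOn_planar_iff {C : ℝ} :
    StretchingSupBoundOn (fun v : UnitAddTorus d → EuclideanSpace ℝ d =>
        ∃ k : d, ∀ x, Torus.partialDeriv k v x = 0) C ↔
      StretchingSupBoundPlanar (d := d) C := Iff.rfl

/-- Monotone in the constant. [ours; elementary] -/
theorem StretchingSupBoundOn.mono {C C' : ℝ} (h : StretchingSupBoundOn 𝒞 C) (hCC' : C ≤ C') :
    StretchingSupBoundOn 𝒞 C' := fun hd v hv hdiv hv𝒞 M hM hω =>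
  (h hd v hv hdiv hv𝒞 M hM hω).trans
    (mul_le_mul_of_nonneg_right (mul_le_mul_of_nonneg_right hCC' hM) (torusEnstrophy_nonneg v))

/-- Antitone in the class. [ours; elementary] -/
theorem StretchingSupBoundOn.anti {C : ℝ} (h : StretchingSupBoundOn 𝒞 C) (h𝒟𝒞 : ∀ v, 𝒟 v → 𝒞 v) :
    StretchingSupBoundOn 𝒟 C := fun hd v hv hdiv hv𝒟 M hM hω => h hd v hv hdiv (h𝒟𝒞 v hv𝒟) M hM hω

/-- Non-empty: Hölder's `2/√3` is valid on every class (tree `stretchingSupHolder_holds`). [ours] -/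
theorem stretchingSupValidOn_nonempty : {C | StretchingSupBoundOn 𝒞 C}.Nonempty :=
  ⟨2 / Real.sqrt 3, (stretchingSupHolder_holds (d := d)).on⟩

/-- A constant violated inside the class is a lower bound of the valid set. [ours] -/
theorem mem_lowerBounds_stretchingSupValidOn {C : ℝ} (h : ¬ StretchingSupBoundOn 𝒞 C) :
    C ∈ lowerBounds {C | StretchingSupBoundOn 𝒞 C} := by
  intro C' hC'
  by_contra hlt
  exact h (StretchingSupBoundOn.mono hC' (not_le.mp hlt).le)

/-- One violated constant bounds the valid set below. [ours] -/
theorem bddBelow_stretchingSupValidOn {C : ℝ} (h : ¬ StretchingSupBoundOn 𝒞 C) :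
    BddBelow {C | StretchingSupBoundOn 𝒞 C} :=
  ⟨C, mem_lowerBounds_stretchingSupValidOn h⟩

/-- **A violation inside the class bounds `C_𝒞` from below** (the census / bank reading). [ours] -/
theorem le_stretchingSupConstOn {C : ℝ} (h : ¬ StretchingSupBoundOn 𝒞 C) :
    C ≤ stretchingSupConstOn 𝒞 :=
  le_csInf stretchingSupValidOn_nonempty (mem_lowerBounds_stretchingSupValidOn h)

/-- Recording lemma: `(∀ C < K, ¬ StretchingSupBoundOn 𝒞 C) → K ≤ C_𝒞`. [ours] -/
theorem le_stretchingSupConstOn_of_forall_lt {K : ℝ} (h : ∀ C < K, ¬ StretchingSupBoundOn 𝒞 C) :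
    K ≤ stretchingSupConstOn 𝒞 :=
  le_of_forall_lt_imp_le_of_dense fun C hC => le_stretchingSupConstOn (h C hC)

/-- A valid constant bounds `C_𝒞` from above, given one violated constant. [ours] -/
theorem stretchingSupConstOn_le {C₀ C : ℝ} (h₀ : ¬ StretchingSupBoundOn 𝒞 C₀)
    (h : StretchingSupBoundOn 𝒞 C) : stretchingSupConstOn 𝒞 ≤ C :=
  csInf_le (bddBelow_stretchingSupValidOn h₀) h

/-- **`C_𝒞 ≤ C⋆`**: a class constant never exceeds the optimal constant of the full row (given one
violated constant in the class, i.e. boundedness below). [ours] -/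
theorem stretchingSupConstOn_le_stretchingSupConst {C₀ : ℝ} (h₀ : ¬ StretchingSupBoundOn 𝒞 C₀) :
    stretchingSupConstOn 𝒞 ≤ stretchingSupConst (d := d) :=
  csInf_le_csInf (bddBelow_stretchingSupValidOn h₀) stretchingSupValid_nonempty
    fun _ hC => (mem_stretchingSupValid.mp hC).on

/-- **`C_𝒟 ≤ C_𝒞` for `𝒟 ⊆ 𝒞`** (given one violated constant in the smaller class). [ours] -/
theorem stretchingSupConstOn_anti {C₀ : ℝ} (h₀ : ¬ StretchingSupBoundOn 𝒟 C₀) (h𝒟𝒞 : ∀ v, 𝒟 v → 𝒞 v) :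
    stretchingSupConstOn 𝒟 ≤ stretchingSupConstOn 𝒞 :=
  csInf_le_csInf (bddBelow_stretchingSupValidOn h₀) stretchingSupValidOn_nonempty
    fun _ hC => StretchingSupBoundOn.anti hC h𝒟𝒞

/-- **`C_𝒞` is attained**: `StretchingSupBoundOn 𝒞 C_𝒞` (a family of non-strict inequalities is closed
under the infimum of the constant; same argument as the tree's `stretchingSupBound_const`). [ours] -/
theorem stretchingSupBoundOn_const : StretchingSupBoundOn 𝒞 (stretchingSupConstOn 𝒞) := by
  intro hd v hv hdiv hv𝒞 M hM hω
  obtain ⟨X, hX, hXdef⟩ : ∃ X : ℝ, 0 ≤ X ∧ X = M * torusEnstrophy v :=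
    ⟨_, mul_nonneg hM (torusEnstrophy_nonneg v), rfl⟩
  have hval : ∀ C' ∈ {C | StretchingSupBoundOn 𝒞 C}, enstrophyProduction v ≤ C' * X := by
    intro C' hC'
    have h' := hC' hd v hv hdiv hv𝒞 M hM hω
    rw [hXdef, ← mul_assoc]; exact h'
  have goal : enstrophyProduction v ≤ stretchingSupConstOn 𝒞 * X := by
    refine le_of_forall_pos_le_add fun ε hε => ?_
    rcases hX.eq_or_lt with hX0 | hXpos
    · obtain ⟨C', hC'⟩ := stretchingSupValidOn_nonempty (𝒞 := 𝒞)
      have h' := hval C' hC'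
      rw [← hX0, mul_zero] at h'
      rw [← hX0, mul_zero, zero_add]
      exact h'.trans hε.le
    · have hXne : X ≠ 0 := hXpos.ne'
      obtain ⟨C', hC'mem, hC'lt⟩ := exists_lt_of_csInf_lt (stretchingSupValidOn_nonempty (𝒞 := 𝒞))
        (lt_add_of_pos_right (stretchingSupConstOn 𝒞) (div_pos hε hXpos))
      have h1 := hval C' hC'mem
      have h2 : C' * X ≤ (stretchingSupConstOn 𝒞 + ε / X) * X :=
        mul_le_mul_of_nonneg_right hC'lt.le hX
      have h3 : (stretchingSupConstOn 𝒞 + ε / X) * X = stretchingSupConstOn 𝒞 * X + ε := by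
        rw [add_mul, div_mul_cancel₀ ε hXne]
      linarith
  rw [hXdef, ← mul_assoc] at goal
  exact goal

/-! ## 2. Two classes: 2½-D fields and pressureless gradients -/

/-- **The 2½-D class**: `v` does not depend on one of the coordinates (`∂ₖv ≡ 0` for some `k`); every
`Torus.twoHalf V R` is in it (`exists_partialDeriv_eq_zero_twoHalf`). [ours] -/
def IsTwoHalfD (v : UnitAddTorus d → EuclideanSpace ℝ d) : Prop :=
  ∃ k : d, ∀ x, Torus.partialDeriv k v x = 0

/-- **The pressureless-gradient class**: `|S(x)|_F² = ½|ω(x)|²` at every point, i.e. `tr((∇v)²) = 0`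
pointwise (for a smooth divergence-free NS datum: `Δp = −tr((∇v)²) = 0`, the pressure is constant).
[ours] -/
def IsPressurelessGrad (v : UnitAddTorus d → EuclideanSpace ℝ d) : Prop :=
  ∀ x, (∑ i, ∑ j, ((Torus.partialDeriv j v x i + Torus.partialDeriv i v x j) / 2) ^ 2) =
    2⁻¹ * torusVorticitySqAt v x

/-- The row on the 2½-D class IS `StretchingSupBoundPlanar`. [ours; bookkeeping] -/
theorem stretchingSupBoundOn_isTwoHalfD_iff {C : ℝ} :
    StretchingSupBoundOn (IsTwoHalfD (d := d)) C ↔ StretchingSupBoundPlanar (d := d) C := Iff.rfl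

/-- **`C_{2.5D} ≤ ½`-half: the row holds on the 2½-D class with constant `½`** (dict
`stretchingSupBoundPlanar_half`). Search for candidate a priori estimates; no regularity claim. [ours] -/
theorem stretchingSupBoundOn_isTwoHalfD_half : StretchingSupBoundOn (IsTwoHalfD (d := d)) (1 / 2) :=
  stretchingSupBoundOn_isTwoHalfD_iff.mpr stretchingSupBoundPlanar_half

/-- **The row holds on the pressureless-gradient class with constant `2√3/9`** (dict
`enstrophyProduction_le_of_strainSq_eq_half_vorticitySq`: Betchov–Miller + `|S|³ ≤ (M/√2)|S|²` +
`∫|S|² = ℰ`). Search for candidate a priori estimates; no regularity claim. [ours] -/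
theorem stretchingSupBoundOn_isPressurelessGrad :
    StretchingSupBoundOn (IsPressurelessGrad (d := d)) (2 * Real.sqrt 3 / 9) :=
  fun hd _ hv hdiv hpl _ hM hω =>
    enstrophyProduction_le_of_strainSq_eq_half_vorticitySq hd hv hdiv hpl hM hω

/-! ## 3. The prove seat's planar family `StretchFamily.u n τ` lies in both classes; kills inside a class -/

namespace StretchFamily

variable {n : ℕ} {τ : ℝ}

/-- `∂₂u_{n,τ} ≡ 0` (as a vector): the family is 2½-dimensional. [ours; elementary, from the prove seat's
`partialDeriv_table`] -/
theorem partialDeriv_two_u (hn : n ≠ 0) (x : UnitAddTorus (Fin 3)) :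
    Torus.partialDeriv 2 (u n τ) x = 0 := by
  obtain ⟨-, -, -, -, -, -, h0, h1, h2⟩ := partialDeriv_table (τ := τ) hn x
  ext j
  fin_cases j
  · simpa using h0
  · simpa using h1
  · simpa using h2

/-- `u_{n,τ} ∈ IsTwoHalfD`. [ours; elementary] -/
theorem isTwoHalfD_u (hn : n ≠ 0) : IsTwoHalfD (u n τ) :=
  ⟨2, partialDeriv_two_u hn⟩

/-- **`u_{n,τ}` has a pressureless gradient**: its only non-zero first derivatives are `∂₀u₂`, `∂₁u₀`,
`∂₁u₂`, so `∇u` is nilpotent, `tr((∇u)²) = 0` and `|S|_F² = ½(a² + b² + c²) = ½|ω|²`. [ours; elementary] -/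
theorem isPressurelessGrad_u (hn : n ≠ 0) : IsPressurelessGrad (u n τ) := by
  intro x
  obtain ⟨h00, h01, h02, h10, h11, h12, h20, h21, h22⟩ := partialDeriv_table (τ := τ) hn x
  rw [torusVorticitySqAt_u hn x]
  simp only [Fin.sum_univ_three, h00, h01, h02, h10, h11, h12, h20, h21, h22]
  ring

/-- **Kills INSIDE a class along the family** (the prove seat's `not_stretchingSupBound_of_lt_r` with the
class hypothesis threaded through): if `u n τ ∈ 𝒞`, `1 ≤ n`, `0 < τ ≤ 1` and `C < r n τ`, then
`StretchingSupBoundOn 𝒞 C` fails (`M = 2π√(2+n²τ²)`, `σ = 2π³nτ`, `ℰ = π²(4+(1+n²)τ²)/2`). Search for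
candidate a priori estimates; no regularity claim. [ours] -/
theorem not_stretchingSupBoundOn_of_lt_r
    {𝒞 : (UnitAddTorus (Fin 3) → EuclideanSpace ℝ (Fin 3)) → Prop} (h𝒞 : 𝒞 (u n τ))
    (hn : 1 ≤ n) (hτ : 0 < τ) (hτ1 : τ ≤ 1) {C : ℝ} (hC : C < r n τ) :
    ¬ StretchingSupBoundOn 𝒞 C := by
  intro h
  have hn0 : n ≠ 0 := by omega
  have hpi := Real.pi_pos
  have hτ2 : τ ^ 2 ≤ 1 := by nlinarith
  have hD1 : 0 < 2 + (n : ℝ) ^ 2 * τ ^ 2 := by positivity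
  obtain ⟨M, hM⟩ : ∃ M, M = 2 * Real.pi * Real.sqrt (2 + (n : ℝ) ^ 2 * τ ^ 2) := ⟨_, rfl⟩
  have hM0 : 0 ≤ M := by rw [hM]; positivity
  have hM2 : M ^ 2 = 4 * Real.pi ^ 2 * (2 + (n : ℝ) ^ 2 * τ ^ 2) := by
    rw [hM, mul_pow, Real.sq_sqrt hD1.le]; ring
  have hω : ∀ x, torusVorticitySqAt (u n τ) x ≤ M ^ 2 := fun x => by
    rw [hM2]; exact torusVorticitySqAt_u_le hn0 hτ2 x
  have hle := h (Fintype.card_fin 3) (u n τ) isSmooth_u (isDivFree_u hn0) h𝒞 M hM0 hω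
  rw [enstrophyProduction_u hn0, torusEnstrophy_u hn0, hM] at hle
  have hD : 0 < Real.sqrt (2 + (n : ℝ) ^ 2 * τ ^ 2) * (4 + (1 + (n : ℝ) ^ 2) * τ ^ 2) := by positivity
  have h3 : 0 < Real.pi ^ 3 := by positivity
  have key : Real.pi ^ 3 * (2 * n * τ -
      C * (Real.sqrt (2 + (n : ℝ) ^ 2 * τ ^ 2) * (4 + (1 + (n : ℝ) ^ 2) * τ ^ 2))) ≤ 0 := by
    nlinarith [hle]
  have key' : 2 * n * τ - C * (Real.sqrt (2 + (n : ℝ) ^ 2 * τ ^ 2) * (4 + (1 + (n : ℝ) ^ 2) * τ ^ 2)) ≤ 0 := by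
    by_contra hcon
    exact absurd key (not_le.2 (mul_pos h3 (lt_of_not_ge hcon)))
  have hrC : r n τ ≤ C := by
    rw [r, div_le_iff₀ hD]; linarith
  linarith

/-- `r n τ ≤ C_𝒞` whenever `u n τ ∈ 𝒞`. [ours] -/
theorem r_le_stretchingSupConstOn
    {𝒞 : (UnitAddTorus (Fin 3) → EuclideanSpace ℝ (Fin 3)) → Prop} (h𝒞 : 𝒞 (u n τ))
    (hn : 1 ≤ n) (hτ : 0 < τ) (hτ1 : τ ≤ 1) : r n τ ≤ stretchingSupConstOn 𝒞 :=
  le_of_forall_lt_imp_le_of_dense fun _ hC =>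
    le_stretchingSupConstOn (not_stretchingSupBoundOn_of_lt_r h𝒞 hn hτ hτ1 hC)

/-- The member `(1,1)` witnesses `¬ StretchingSupBoundOn 𝒞 0` (indeed every `C < √3/9`) for every class
containing it — the lower witness that makes `stretchingSupConstOn 𝒞` a genuine infimum. [ours; elementary] -/
theorem not_stretchingSupBoundOn_zero
    {𝒞 : (UnitAddTorus (Fin 3) → EuclideanSpace ℝ (Fin 3)) → Prop} (h𝒞 : 𝒞 (u 1 1)) :
    ¬ StretchingSupBoundOn 𝒞 0 :=
  not_stretchingSupBoundOn_of_lt_r h𝒞 le_rfl one_pos le_rfl (by rw [r_one_one]; positivity)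

/-- `√3/9 ≤ C_𝒞` for every class containing the member `(1,1)`. [ours] -/
theorem sqrt_three_div_nine_le_stretchingSupConstOn
    {𝒞 : (UnitAddTorus (Fin 3) → EuclideanSpace ℝ (Fin 3)) → Prop} (h𝒞 : 𝒞 (u 1 1)) :
    Real.sqrt 3 / 9 ≤ stretchingSupConstOn 𝒞 := by
  rw [← r_one_one]; exact r_le_stretchingSupConstOn h𝒞 le_rfl one_pos le_rfl

/-- **`√(71−17√17)/4 ≤ C_𝒞` for every class containing the whole family** (the envelope `n → ∞`,
`τ = λ⋆/n`, exactly as the prove seat's `envelopeConst_le_stretchingSupConst`). Search for candidate a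
priori estimates; no regularity claim. [ours] -/
theorem sqrt_envelope_le_stretchingSupConstOn
    {𝒞 : (UnitAddTorus (Fin 3) → EuclideanSpace ℝ (Fin 3)) → Prop} (h𝒞 : ∀ n τ, 1 ≤ n → 𝒞 (u n τ)) :
    Real.sqrt (71 - 17 * Real.sqrt 17) / 4 ≤ stretchingSupConstOn 𝒞 := by
  rw [← envelopeConst_eq]
  obtain ⟨hl0, hl2, _⟩ := lamStar_facts
  refine le_of_tendsto tendsto_r_lamStar (eventually_atTop.2 ⟨2, fun n hn => ?_⟩)
  have hn' : (2 : ℝ) ≤ n := by exact_mod_cast hn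
  have hnpos : (0 : ℝ) < n := by linarith
  exact r_le_stretchingSupConstOn (h𝒞 n _ (by omega)) (by omega) (div_pos hl0 hnpos)
    ((div_le_one hnpos).2 (hl2.trans hn'))

end StretchFamily

/-! ## 4. The two class constants on `T³` (part 1: tree-only bounds) -/

/-- The 2½-D class contains the member `(1,1)`: `¬ StretchingSupBoundOn IsTwoHalfD 0`. [ours; elementary] -/
theorem not_stretchingSupBoundOn_isTwoHalfD_zero : ¬ StretchingSupBoundOn (IsTwoHalfD (d := Fin 3)) 0 :=
  StretchFamily.not_stretchingSupBoundOn_zero (StretchFamily.isTwoHalfD_u one_ne_zero)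

/-- The pressureless class contains the member `(1,1)`: `¬ StretchingSupBoundOn IsPressurelessGrad 0`.
[ours; elementary] -/
theorem not_stretchingSupBoundOn_isPressurelessGrad_zero :
    ¬ StretchingSupBoundOn (IsPressurelessGrad (d := Fin 3)) 0 :=
  StretchFamily.not_stretchingSupBoundOn_zero (StretchFamily.isPressurelessGrad_u one_ne_zero)

/-- **`C_{2.5D} ≤ ½`** (tree `stretchingSupBoundPlanar_half` / `enstrophyProduction_le_half_of_partialDeriv_eq_zero`,
p206571; the bank's hand theorem says `= ½`, typed as the node `PlanarCellFamily` in
`StretchingNestedTargets.lean`, not formalised). Search for candidate a priori estimates; no regularity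
claim. [ours] -/
theorem stretchingSupConstOn_isTwoHalfD_le_half :
    stretchingSupConstOn (IsTwoHalfD (d := Fin 3)) ≤ 1 / 2 :=
  stretchingSupConstOn_le not_stretchingSupBoundOn_isTwoHalfD_zero stretchingSupBoundOn_isTwoHalfD_half

/-- **`C_pressureless ≤ 2√3/9`** (tree `enstrophyProduction_le_of_strainSq_eq_half_vorticitySq`, p206571).
Search for candidate a priori estimates; no regularity claim. [ours] -/
theorem stretchingSupConstOn_isPressurelessGrad_le :
    stretchingSupConstOn (IsPressurelessGrad (d := Fin 3)) ≤ 2 * Real.sqrt 3 / 9 :=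
  stretchingSupConstOn_le not_stretchingSupBoundOn_isPressurelessGrad_zero
    stretchingSupBoundOn_isPressurelessGrad

/-- **`√(71−17√17)/4 ≤ C_{2.5D}`** (the prove seat's family envelope, inside the class). [ours] -/
theorem sqrt_envelope_le_stretchingSupConstOn_isTwoHalfD :
    Real.sqrt (71 - 17 * Real.sqrt 17) / 4 ≤ stretchingSupConstOn (IsTwoHalfD (d := Fin 3)) :=
  StretchFamily.sqrt_envelope_le_stretchingSupConstOn fun _ _ hn =>
    StretchFamily.isTwoHalfD_u (by omega)

/-- **`√(71−17√17)/4 ≤ C_pressureless`**. [ours] -/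
theorem sqrt_envelope_le_stretchingSupConstOn_isPressurelessGrad :
    Real.sqrt (71 - 17 * Real.sqrt 17) / 4 ≤ stretchingSupConstOn (IsPressurelessGrad (d := Fin 3)) :=
  StretchFamily.sqrt_envelope_le_stretchingSupConstOn fun _ _ hn =>
    StretchFamily.isPressurelessGrad_u (by omega)

/-- `C_{2.5D} ≤ C⋆`. [ours; elementary] -/
theorem stretchingSupConstOn_isTwoHalfD_le_stretchingSupConst :
    stretchingSupConstOn (IsTwoHalfD (d := Fin 3)) ≤ stretchingSupConst (d := Fin 3) :=
  stretchingSupConstOn_le_stretchingSupConst not_stretchingSupBoundOn_isTwoHalfD_zero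

/-- `C_pressureless ≤ C⋆`. [ours; elementary] -/
theorem stretchingSupConstOn_isPressurelessGrad_le_stretchingSupConst :
    stretchingSupConstOn (IsPressurelessGrad (d := Fin 3)) ≤ stretchingSupConst (d := Fin 3) :=
  stretchingSupConstOn_le_stretchingSupConst not_stretchingSupBoundOn_isPressurelessGrad_zero

/-- **Part-1 chain of K1-Q1 constants on `T³` (tree-only inputs)**:
`0.2381 ≤ C_pressureless ≤ 2√3/9`, `0.2381 ≤ C_{2.5D} ≤ ½`, `C_{2.5D} ≤ C⋆ ≤ 2/√3`. Part 2 sharpens both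
lower halves to `2√3/9`. Search for candidate a priori estimates; no regularity claim. [ours] -/
theorem stretchingSupConstOn_chain₁ :
    (Real.sqrt (71 - 17 * Real.sqrt 17) / 4 ≤ stretchingSupConstOn (IsPressurelessGrad (d := Fin 3)) ∧
      stretchingSupConstOn (IsPressurelessGrad (d := Fin 3)) ≤ 2 * Real.sqrt 3 / 9) ∧
    (Real.sqrt (71 - 17 * Real.sqrt 17) / 4 ≤ stretchingSupConstOn (IsTwoHalfD (d := Fin 3)) ∧
      stretchingSupConstOn (IsTwoHalfD (d := Fin 3)) ≤ 1 / 2) ∧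
    stretchingSupConstOn (IsTwoHalfD (d := Fin 3)) ≤ stretchingSupConst (d := Fin 3) ∧
    stretchingSupConst (d := Fin 3) ≤ 2 / Real.sqrt 3 :=
  ⟨⟨sqrt_envelope_le_stretchingSupConstOn_isPressurelessGrad, stretchingSupConstOn_isPressurelessGrad_le⟩,
    ⟨sqrt_envelope_le_stretchingSupConstOn_isTwoHalfD, stretchingSupConstOn_isTwoHalfD_le_half⟩,
    stretchingSupConstOn_isTwoHalfD_le_stretchingSupConst, stretchingSupConst_le_holder⟩

end Summit.NavierStokesRegularity.FunctionalMining

end
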